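import Summits.KontsevichZagierPeriods.KontsevichZagierPeriods.Theorems.SoloBlindCircleSegment
import HarnessLib

/-!
# The area of a rational circular segment, read off from the Kontsevich–Zagier moves

Companion to `SoloBlindCircleSegment`: the two moves `C_a ≡ S₁ ≡ ρ_a` proved there give
`area(C_a) = ∫₀^{τ_a} 8t²/((1-a)(1+t²)³) dt = (arctan τ_a - a(1+a)τ_a/2)/(1-a)`,
`τ_a = √((1-a)/(1+a))` (`= (arccos a - a√(1-a²))/(2(1-a))`), by an explicit rational-plus-arctan
primitive — the value of a 2-dimensional `ℚ`-rational period computed purely through the rules.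

References: Kontsevich–Zagier, *Periods* (2001), §1.1–1.2. -/

noncomputable section

namespace Summit.KontsevichZagierPeriods.KontsevichZagierPeriods.Theorems

open Set MeasureTheory
open Literature.ModelTheory.ExponentialFields (IsSemialgebraic)
open MvPolynomial (aeval X C)
open Literature.NumberTheory.Transcendental
open Literature.NumberTheory.Transcendental.KZ

namespace SoloBlind

variable (a : ℚ)

/-! ## The area, read off from the moves -/

/-- A primitive of `g`: `G(t) = (arctan t - (t-t³)/(1+2t²+t⁴))/(1-a)`. -/
def segPrim (t : ℝ) : ℝ := (Real.arctan t - (t - t ^ 3) / (1 + 2 * t ^ 2 + t ^ 4)) / (1 - a)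

/-- `G' = g`. -/
theorem hasDerivAt_segPrim (ha1 : a < 1) (t : ℝ) : HasDerivAt (segPrim a) (circG a t) t := by
  have ha1' : (a:ℝ) < 1 := by exact_mod_cast ha1
  have hp : (0:ℝ) < 1 + 2 * t ^ 2 + t ^ 4 := by positivity
  have h1 : HasDerivAt (fun y : ℝ => y - y ^ 3) (1 - 3 * t ^ 2) t :=
    ((hasDerivAt_id' t).sub (hasDerivAt_pow 3 t)).congr_deriv (by norm_num)
  have h2 : HasDerivAt (fun y : ℝ => 1 + 2 * y ^ 2 + y ^ 4) (4 * t + 4 * t ^ 3) t :=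
    ((((hasDerivAt_pow 2 t).const_mul 2).const_add 1).add (hasDerivAt_pow 4 t)).congr_deriv
      (by norm_num; ring)
  refine (((Real.hasDerivAt_arctan t).sub (h1.div h2 hp.ne')).div_const ((1:ℝ) - a)).congr_deriv
    ?_
  have h3 : (1:ℝ) - a ≠ 0 := by linarith
  have h4 : (1:ℝ) + t ^ 2 ≠ 0 := by positivity
  have h5 : (1:ℝ) + 2 * t ^ 2 + t ^ 4 ≠ 0 := hp.ne'
  rw [circG]
  field_simp
  ring

/-- `∫_{ρ_a} = G(τ_a) = (arctan τ_a - a(1+a)τ_a/2)/(1-a)`. -/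
theorem segRho_value (ha0 : 0 ≤ a) (ha1 : a < 1) :
    (segRho a ha0 ha1).value =
      (Real.arctan (tau a) - (a:ℝ) * (1 + a) * tau a / 2) / (1 - a) := by
  have hle := (tau_pos a ha0 ha1).le
  have ha0' : (0:ℝ) ≤ a := by exact_mod_cast ha0
  rw [segRho, value_lineRep, ← integral_Ioc_eq_integral_Ioo, ← intervalIntegral.integral_of_le hle,
    intervalIntegral.integral_eq_sub_of_hasDerivAt (f := segPrim a)
      (fun x _ => hasDerivAt_segPrim a ha1 x)
      ((continuous_circG a ha1).intervalIntegrable _ _)]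
  have h0 : segPrim a 0 = 0 := by simp [segPrim]
  rw [h0, sub_zero, segPrim, show tau a ^ 3 = tau a * tau a ^ 2 by ring,
    show tau a ^ 4 = (tau a ^ 2) ^ 2 by ring, tau_sq a ha0 ha1]
  have h2 : (1:ℝ) + a ≠ 0 := by linarith
  field_simp
  ring

/-- **`area(C_a) = (arctan τ_a - a(1+a)τ_a/2)/(1-a)`** (`= (arccos a - a√(1-a²))/(2(1-a))`). -/
theorem seg2_value (ha0 : 0 ≤ a) (ha1 : a < 1) :
    (seg2 a).value = (Real.arctan (tau a) - (a:ℝ) * (1 + a) * tau a / 2) / (1 - a) := by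
  rw [← segRho_value a ha0 ha1]
  exact Equivalent.value_eq_holds (mkQ_eq_mkQ_iff.mp (mkQ_seg2 a ha0 ha1))

end SoloBlind

end Summit.KontsevichZagierPeriods.KontsevichZagierPeriods.Theorems
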